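import Mathlib.LinearAlgebra.Matrix.Hermitian
import Mathlib.LinearAlgebra.Matrix.NonsingularInverse
import Mathlib.LinearAlgebra.Matrix.Charpoly.Coeff
import Mathlib.Algebra.Polynomial.Roots
import Mathlib.Analysis.Complex.Basic
import Mathlib.Topology.Instances.Matrix
import HarnessLib

/-!
# The Cayley transform for the unitary group of a complex hermitian form (with a unit scalar)

Topic `GroupTheory/ArithmeticGroups`; namespace `Literature.GroupTheory.ArithmeticGroups.RealApproximationCM`.
Pure complex-matrix algebra, everything proved; the input of the real-approximation theorem for unitary
groups over CM fields (`UnitaryRealApproximationCM.lean`, Cayley's method run at all archimedean places).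

For a complex matrix `H` (in the application `H = Hᴴ` non-degenerate) write `U(H) = {u : uᴴ H u = H}` and
`𝔲(H) = {X : Xᴴ H + H X = 0}` (its Lie algebra). With a scalar `α` of absolute value `1`:

* `cayley_mem` — for `X ∈ 𝔲(H)` with `1 + X` invertible, `u = α (1 − X)(1 + X)⁻¹ ∈ U(H)`;
* `cayleyInv_mem_lie` — for `u ∈ U(H)` with `A = α·1 + u` invertible, `X = A⁻¹ (α·1 − u) ∈ 𝔲(H)`;
* `cayleyInv_eq` — and then `1 + X = 2α A⁻¹` is invertible and `α (1 − X)(1 + X)⁻¹ = u`;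
* `exists_isUnit_smul_one_add` — bookkeeping: `{z : det (z·1 + u) = 0}` is finite (roots of the characteristic
  polynomial of `−u`), so any infinite set of scalars contains an `α` with `α·1 + u` invertible;
* `skewElem i j c = c e_{ij} − c̄ e_{ji}` — the elementary skew-hermitian matrices, `sum_skewElem_eq` (a
  skew-hermitian `Y` is `∑_{i,j} skewElem i j (Y i j / 2)`), `conjTranspose_skewElem`, `continuous_skewElem`;
* `det_ne_zero_of_unitary` — elements of `U(H)`, `det H ≠ 0`, are invertible.

The scalar `α` is what makes the method work at a general `u ∈ U(H)` (where `1 + u` may be singular): one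
Cayley chart `X ↦ α(1 − X)(1 + X)⁻¹` through `α` covers `{u : det(α + u) ≠ 0}`, and `α` is later taken in the
image of the norm-one torus of the CM field. The sibling `UnitaryRealApproximation.lean` (namespace
`….ArithmeticGroups.RealApproximation`, one complex place, `K ⊆ ℂ` a dense subfield) uses the chart
`(1 + X)(1 − X)⁻¹` and rational points of the unit circle instead; the two files are independent.

Provenance: `pub-hodgecm` package file `HodgeCM/Literature/RealApproximation.lean` (gen 4, gate run 23), Parts A/C/D
(the field-independent lemmas), ported verbatim up to names.

## References

* V. Platonov, A. Rapinchuk, *Algebraic Groups and Number Theory*, Academic Press 1994, §7.1 (proof of Thm. 7.7 via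
  rationality of the Cayley map for classical groups, cf. §2.3). [PlatonovRapinchuk1994]
* A. Weil, *Algebras with involutions and the classical groups*, J. Indian Math. Soc. 24 (1960) 589–623 (Cayley
  parametrisation of unitary groups). [folklore]
-/

noncomputable section

open Matrix Topology
open scoped ComplexConjugate

namespace Literature.GroupTheory.ArithmeticGroups.RealApproximationCM

variable {m : Type*} [Fintype m] [DecidableEq m]

/-! ### Elementary skew-hermitian matrices -/

/-- The elementary skew-hermitian matrices `E(i,j;c) := c·e_{ij} − c̄·e_{ji}`. [folklore] -/
def skewElem (i j : m) (c : ℂ) : Matrix m m ℂ :=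
  c • Matrix.single i j (1 : ℂ) - (starRingEnd ℂ c) • Matrix.single j i (1 : ℂ)

omit [Fintype m] in
/-- Entries of `E(i,j;c)`. [folklore] -/
theorem skewElem_apply (i j : m) (c : ℂ) (a b : m) :
    skewElem i j c a b = (if i = a ∧ j = b then c else 0) - (if j = a ∧ i = b then starRingEnd ℂ c else 0) := by
  simp only [skewElem, Matrix.sub_apply, Matrix.smul_apply, Matrix.single, Matrix.of_apply, smul_eq_mul, mul_ite,
    mul_one, mul_zero]

omit [Fintype m] in
/-- `c ↦ E(i,j;c)` is continuous. [folklore] -/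
theorem continuous_skewElem (i j : m) : Continuous (skewElem (m := m) i j) :=
  (continuous_id.smul continuous_const).sub (Complex.continuous_conj.smul continuous_const)

/-- A skew-hermitian matrix is the sum of the `E(i,j; y_{ij}/2)`. [folklore] -/
theorem sum_skewElem_eq (Y : Matrix m m ℂ) (hY : Yᴴ = -Y) :
    ∑ i, ∑ j, skewElem i j (Y i j / 2) = Y := by
  ext a b
  have hba : starRingEnd ℂ (Y b a) = -Y a b := by
    have := congrFun (congrFun hY a) b
    simpa [Matrix.conjTranspose_apply] using this
  simp only [Matrix.sum_apply, skewElem_apply, Finset.sum_sub_distrib, ite_and, Finset.sum_ite_eq',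
    Finset.mem_univ, if_true, map_div₀, map_ofNat, hba]
  rw [Finset.sum_comm]
  simp [Finset.sum_ite_eq']
  ring

omit [Fintype m] in
/-- `E(i,j;c)` is skew-hermitian. [folklore] -/
theorem conjTranspose_skewElem (i j : m) (c : ℂ) : (skewElem i j c)ᴴ = -skewElem i j c := by
  unfold skewElem
  rw [Matrix.conjTranspose_sub, Matrix.conjTranspose_smul, Matrix.conjTranspose_smul, Matrix.conjTranspose_single,
    Matrix.conjTranspose_single, star_one]
  simp only [Complex.star_def, Complex.conj_conj, neg_sub]

/-! ### The Cayley transform with a unit scalar -/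

/-- **Cayley.** For `X ∈ 𝔲(H)` (`Xᴴ H + H X = 0`) with `1 + X` invertible and `|α| = 1`, the matrix
`u = α (1 − X)(1 + X)⁻¹` preserves `H`: `uᴴ H u = H`. [folklore] -/
theorem cayley_mem {Hc X : Matrix m m ℂ} (hX : Xᴴ * Hc + Hc * X = 0) (h1 : IsUnit (1 + X).det) {α : ℂ}
    (hα : starRingEnd ℂ α * α = 1) :
    (α • ((1 - X) * (1 + X)⁻¹))ᴴ * Hc * (α • ((1 - X) * (1 + X)⁻¹)) = Hc := by
  have hXH : Xᴴ * Hc = -(Hc * X) := eq_neg_of_add_eq_zero_left hX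
  have k1 : (1 - Xᴴ) * Hc = Hc * (1 + X) := by
    rw [Matrix.sub_mul, Matrix.one_mul, hXH, Matrix.mul_add, Matrix.mul_one, sub_neg_eq_add]
  have k2 : Hc * (1 - X) = (1 + Xᴴ) * Hc := by
    rw [Matrix.mul_sub, Matrix.mul_one, Matrix.add_mul, Matrix.one_mul, hXH, sub_eq_add_neg]
  have h1' : IsUnit (1 + Xᴴ).det := by
    have : (1 + Xᴴ) = (1 + X)ᴴ := by rw [Matrix.conjTranspose_add, Matrix.conjTranspose_one]
    rw [this, Matrix.det_conjTranspose]
    exact h1.star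
  have hcomm : (1 + X) * (1 - X) = (1 - X) * (1 + X) := by
    simp only [Matrix.mul_sub, Matrix.sub_mul, Matrix.mul_one, Matrix.one_mul, Matrix.mul_add, Matrix.add_mul]
    abel
  rw [Matrix.conjTranspose_smul, Matrix.conjTranspose_mul, Matrix.conjTranspose_nonsing_inv,
    Matrix.conjTranspose_sub, Matrix.conjTranspose_add, Matrix.conjTranspose_one]
  rw [Matrix.smul_mul, Matrix.smul_mul, Matrix.mul_smul, smul_smul, Complex.star_def, hα, one_smul]
  calc (1 + Xᴴ)⁻¹ * (1 - Xᴴ) * Hc * ((1 - X) * (1 + X)⁻¹)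
      = (1 + Xᴴ)⁻¹ * ((1 - Xᴴ) * Hc) * (1 - X) * (1 + X)⁻¹ := by simp only [Matrix.mul_assoc]
    _ = (1 + Xᴴ)⁻¹ * Hc * ((1 + X) * (1 - X)) * (1 + X)⁻¹ := by rw [k1]; simp only [Matrix.mul_assoc]
    _ = (1 + Xᴴ)⁻¹ * Hc * (1 - X) * ((1 + X) * (1 + X)⁻¹) := by rw [hcomm]; simp only [Matrix.mul_assoc]
    _ = (1 + Xᴴ)⁻¹ * (Hc * (1 - X)) := by rw [Matrix.mul_nonsing_inv _ h1, Matrix.mul_one, Matrix.mul_assoc]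
    _ = (1 + Xᴴ)⁻¹ * (1 + Xᴴ) * Hc := by rw [k2, Matrix.mul_assoc]
    _ = Hc := by rw [Matrix.nonsing_inv_mul _ h1', Matrix.one_mul]

/-- **Inverse Cayley, (i).** For `u ∈ U(H)` and `|α| = 1` with `A = α·1 + u` invertible, `X = A⁻¹ (α·1 − u)` lies
in `𝔲(H)`. Proof: `Aᴴ (Xᴴ H + H X) A = Bᴴ H A + Aᴴ H B = 2|α|² H − 2 uᴴ H u = 0` (`B = α·1 − u`, `X A = B`).
[folklore] -/
theorem cayleyInv_mem_lie {Hc u : Matrix m m ℂ} (hu : uᴴ * Hc * u = Hc) {α : ℂ} (hα : starRingEnd ℂ α * α = 1)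
    (hA : IsUnit (α • (1 : Matrix m m ℂ) + u).det) :
    ((α • (1 : Matrix m m ℂ) + u)⁻¹ * (α • 1 - u))ᴴ * Hc +
      Hc * ((α • (1 : Matrix m m ℂ) + u)⁻¹ * (α • 1 - u)) = 0 := by
  set A : Matrix m m ℂ := α • 1 + u with hAd
  set B : Matrix m m ℂ := α • 1 - u with hBd
  set X : Matrix m m ℂ := A⁻¹ * B with hXd
  have hAB : A * B = B * A := by
    simp only [hAd, hBd, Matrix.mul_sub, Matrix.sub_mul, Matrix.mul_add, Matrix.add_mul, Matrix.smul_mul,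
      Matrix.mul_smul, Matrix.one_mul, Matrix.mul_one, smul_add, smul_sub, smul_smul]
    abel
  have hXA : X * A = B := by
    rw [hXd, Matrix.mul_assoc, ← hAB, ← Matrix.mul_assoc, Matrix.nonsing_inv_mul _ hA, Matrix.one_mul]
  have hAX : Aᴴ * Xᴴ = Bᴴ := by rw [← Matrix.conjTranspose_mul, hXA]
  have hcore : Bᴴ * Hc * A + Aᴴ * Hc * B = 0 := by
    have hP : uᴴ * Hc * u = Hc := hu
    have hα' : α * starRingEnd ℂ α = 1 := by rw [mul_comm]; exact hα
    simp only [hAd, hBd, Matrix.conjTranspose_add, Matrix.conjTranspose_sub, Matrix.conjTranspose_smul,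
      Matrix.conjTranspose_one, Complex.star_def]
    simp only [Matrix.add_mul, Matrix.sub_mul, Matrix.mul_add, Matrix.mul_sub, Matrix.smul_mul, Matrix.mul_smul,
      Matrix.one_mul, Matrix.mul_one, smul_add, smul_sub, smul_smul, hP, hα', one_smul]
    abel
  have hconj : Aᴴ * (Xᴴ * Hc + Hc * X) * A = 0 := by
    calc Aᴴ * (Xᴴ * Hc + Hc * X) * A = (Aᴴ * Xᴴ) * Hc * A + Aᴴ * Hc * (X * A) := by
          simp only [Matrix.mul_add, Matrix.add_mul, Matrix.mul_assoc]
      _ = 0 := by rw [hAX, hXA, hcore]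
  have hA' : IsUnit Aᴴ.det := by rw [Matrix.det_conjTranspose]; exact hA.star
  have : Xᴴ * Hc + Hc * X = Aᴴ⁻¹ * (Aᴴ * (Xᴴ * Hc + Hc * X) * A) * A⁻¹ := by
    rw [Matrix.mul_assoc Aᴴ, ← Matrix.mul_assoc Aᴴ⁻¹, Matrix.nonsing_inv_mul _ hA', Matrix.one_mul,
      Matrix.mul_assoc, Matrix.mul_nonsing_inv _ hA, Matrix.mul_one]
  rw [this, hconj, Matrix.mul_zero, Matrix.zero_mul]

/-- **Inverse Cayley, (ii)–(iii).** With `A = α·1 + u` invertible and `α ≠ 0`, `X = A⁻¹ (α·1 − u)` has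
`1 + X = 2α A⁻¹` invertible and `α (1 − X)(1 + X)⁻¹ = u`. [folklore] -/
theorem cayleyInv_eq {u : Matrix m m ℂ} {α : ℂ} (hα0 : α ≠ 0) (hA : IsUnit (α • (1 : Matrix m m ℂ) + u).det) :
    IsUnit (1 + (α • (1 : Matrix m m ℂ) + u)⁻¹ * (α • 1 - u)).det ∧
      α • ((1 - (α • (1 : Matrix m m ℂ) + u)⁻¹ * (α • 1 - u)) *
        (1 + (α • (1 : Matrix m m ℂ) + u)⁻¹ * (α • 1 - u))⁻¹) = u := by
  set A : Matrix m m ℂ := α • 1 + u with hAd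
  set B : Matrix m m ℂ := α • 1 - u with hBd
  have h2α : (2 * α) ≠ 0 := mul_ne_zero two_ne_zero hα0
  have hApB : A + B = (2 * α) • (1 : Matrix m m ℂ) := by
    rw [hAd, hBd, mul_smul, two_smul]; abel
  have hAmB : A - B = (2 : ℂ) • u := by
    rw [hAd, hBd, two_smul]; abel
  have hA1 : A⁻¹ * A = 1 := Matrix.nonsing_inv_mul _ hA
  have h1X : 1 + A⁻¹ * B = (2 * α) • A⁻¹ := by
    calc 1 + A⁻¹ * B = A⁻¹ * A + A⁻¹ * B := by rw [hA1]
      _ = A⁻¹ * (A + B) := (Matrix.mul_add _ _ _).symm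
      _ = (2 * α) • A⁻¹ := by rw [hApB, Matrix.mul_smul, Matrix.mul_one]
  have h1X' : 1 - A⁻¹ * B = (2 : ℂ) • (A⁻¹ * u) := by
    calc 1 - A⁻¹ * B = A⁻¹ * A - A⁻¹ * B := by rw [hA1]
      _ = A⁻¹ * (A - B) := (Matrix.mul_sub _ _ _).symm
      _ = (2 : ℂ) • (A⁻¹ * u) := by rw [hAmB, Matrix.mul_smul]
  have hunit : IsUnit (1 + A⁻¹ * B).det := by
    rw [h1X, Matrix.det_smul]
    exact (IsUnit.pow _ (isUnit_iff_ne_zero.mpr h2α)).mul (Matrix.isUnit_nonsing_inv_det _ hA)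
  refine ⟨hunit, ?_⟩
  have hinv : (1 + A⁻¹ * B)⁻¹ = (2 * α)⁻¹ • A := by
    rw [h1X]
    apply Matrix.inv_eq_left_inv
    rw [Matrix.smul_mul, Matrix.mul_smul, smul_smul, inv_mul_cancel₀ h2α, one_smul, Matrix.mul_nonsing_inv _ hA]
  have huA : u * A = A * u := by
    simp only [hAd, Matrix.mul_add, Matrix.add_mul, Matrix.mul_smul, Matrix.smul_mul, Matrix.mul_one, Matrix.one_mul]
  rw [hinv, h1X', Matrix.smul_mul, Matrix.mul_smul, smul_smul, smul_smul, Matrix.mul_assoc, huA, ← Matrix.mul_assoc,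
    Matrix.nonsing_inv_mul _ hA, Matrix.one_mul]
  have : α * 2 * (2 * α)⁻¹ = 1 := by field_simp
  rw [this, one_smul]

/-! ### Bookkeeping: invertible elements, good scalars -/

/-- Elements of `U(H)` (`det H ≠ 0`) have non-zero determinant. [folklore] -/
theorem det_ne_zero_of_unitary {Hc v : Matrix m m ℂ} (hH : IsUnit Hc.det) (hv : vᴴ * Hc * v = Hc) : v.det ≠ 0 := by
  intro h0
  have := congrArg Matrix.det hv
  rw [Matrix.det_mul, Matrix.det_mul, h0, mul_zero] at this
  exact hH.ne_zero this.symm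

/-- The scalars `z` with `z·1 + u` singular are the roots of the characteristic polynomial of `−u`; there are
finitely many. [folklore] -/
theorem finite_setOf_det_smul_one_add_eq_zero (u : Matrix m m ℂ) :
    {z : ℂ | (z • (1 : Matrix m m ℂ) + u).det = 0}.Finite := by
  have hfin : {z : ℂ | Polynomial.IsRoot (-u).charpoly z}.Finite :=
    Polynomial.finite_setOf_isRoot (Matrix.charpoly_monic (-u)).ne_zero
  refine hfin.subset fun z hz => ?_
  simp only [Set.mem_setOf_eq, Polynomial.IsRoot.def, Matrix.eval_charpoly, Matrix.scalar_apply,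
    ← Matrix.smul_one_eq_diagonal, sub_neg_eq_add]
  exact hz

/-- From any infinite set of scalars one can pick `α` with `α·1 + u` invertible. [folklore] -/
theorem exists_isUnit_smul_one_add {S : Set ℂ} (hS : S.Infinite) (u : Matrix m m ℂ) :
    ∃ α ∈ S, IsUnit (α • (1 : Matrix m m ℂ) + u).det := by
  obtain ⟨α, hαS, hα⟩ := hS.exists_notMem_finite (finite_setOf_det_smul_one_add_eq_zero u)
  exact ⟨α, hαS, isUnit_iff_ne_zero.mpr hα⟩

/-- The Cayley chart `X ↦ α (1 − X)(1 + X)⁻¹` is continuous at every `X` with `1 + X` invertible. [folklore] -/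
theorem continuousAt_cayley (α : ℂ) {X : Matrix m m ℂ} (h1X : IsUnit (1 + X).det) :
    ContinuousAt (fun M : Matrix m m ℂ => α • ((1 - M) * (1 + M)⁻¹)) X := by
  have h1 : ContinuousAt (fun M : Matrix m m ℂ => (1 + M)⁻¹) X := by
    have hi : ContinuousAt Ring.inverse (1 + X).det := by
      rw [Ring.inverse_eq_inv']
      exact continuousAt_inv₀ h1X.ne_zero
    exact (continuousAt_matrix_inv (1 + X) hi).comp (continuous_const.add continuous_id).continuousAt
  exact ((continuous_const.sub continuous_id).continuousAt.mul h1).const_smul α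

end Literature.GroupTheory.ArithmeticGroups.RealApproximationCM

end
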